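import Summits.ValiantsHypothesis.ValiantsHypothesis.Theses.RealTau
import Literature.Computability.AlgebraicComplexity.RealTauKnownCases

/-!
# `RealTau.RealVnTransfer` (stmt-ValiantsHypothesis-18102) — negative side: the size budget is load-bearing

Refuter (crux disprover, 2026-08-17), from `Cruxes/RealVnTransfer/Disproof.lean` §(a)–(c).
The crux is Tavenas 2014, Thm. 3.38 with constants: `PER` p-computable over `ℂ` ⟹ every `V_n` is, in
`ℝ[X]`, `∑_{i<k} ∏_{j<m} g_ij` with `k, t ≤ (n+2)^(C(⌊√(2n+3)⌋+1))`, `m ≤ C(⌊√(2n+3)⌋+1)`, `g_ij`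
`t`-sparse.  It is NOT refuted here (its antecedent is `¬`VH by `perNotPComputableComplex_iff_holds`,
so `¬ RealVnTransfer` would entail `VP_ℂ = VNP_ℂ`; see `isPComputable_of_not_realVnTransfer`).
What is certified, all by MONOMIAL COUNTING (`#supp V_n = 2^n`, `#supp ∑∏ g ≤ k t^m`):

* `sumProd_ne_map_tavenasV_of_lt` — any ΣΠ-sparse expression of `V_n` has `k · t^m ≥ 2^n`;
* `realVnTransfer_conclusion_false_of_budget_lt` — hence the conclusion dies under ANY budget
  `(K, M, T)` with `K(n) T(n)^(M(n)) < 2^n` for one `n`;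
* the two natural strengthenings of the conclusion inside the `2^(O(√n log n))` regime are FALSE
  outright (so, as transfer statements under the crux's antecedent, they would be equivalent to
  `¬ IsPComputable (per/ℂ)`, i.e. to the summit — `not_isPComputable_of_transfer_bounded_fanin`):
  `realVnTransfer_false_with_bounded_fanin` (`m ≤ C` instead of `m ≤ C(⌊√(2n+3)⌋+1)`) and
  `realVnTransfer_false_with_poly_sparsity` (`t ≤ (n+2)^C` instead of `t ≤ (n+2)^(C(⌊√(2n+3)⌋+1))`);
  the stated budget allows `k t^m = 2^(Θ(n log n)) ≥ 2^n` and is not touched by counting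
  (`two_pow_le_stated_budget`: for `C ≥ 1` the budget product exceeds `2^n` at EVERY `n`);
* `realVnTransfer_false_at_C_zero` — the exponent `C = 0` fails (at `n = 1`), and
  `realVnTransfer_conclusion_forall_n_exists_C` — the quantifier-swapped conclusion `∀ n ∃ C …` is a
  triviality (`V_n` as `2^n` monomials), so `∃ C` first is the whole content;
* `realVnTransfer_conclusion_false_of_vnSparseHard` — with the antecedent dropped, the conclusion is
  refuted by the route's own target `VnSparseHard` (the antecedent is load-bearing unless the route dies).
No facts and no `def`s. [folklore]
-/

set_option linter.dupNamespace false

namespace Summit.ValiantsHypothesis.ValiantsHypothesis.Theorems.RealVnTransfer.Negative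

open Polynomial Finset
open Literature.Computability.AlgebraicComplexity
open Summit.ValiantsHypothesis.ValiantsHypothesis.Theses.RealTau

/-! ### Monomial counting -/

/-- The support of `V_n` over `ℝ` is `{0, …, 2^n - 1}` (all coefficients are powers of two). [folklore] -/
theorem support_map_tavenasV (n : ℕ) :
    ((tavenasV n).map (Int.castRingHom ℝ)).support = range (2 ^ n) := by
  ext i
  rw [mem_support_iff, coeff_map, coeff_tavenasV, mem_range]
  split_ifs with h
  · simp [h]
  · simp [h]

/-- `V_n` has exactly `2^n` monomials over `ℝ`. [folklore] -/
theorem card_support_map_tavenasV (n : ℕ) :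
    ((tavenasV n).map (Int.castRingHom ℝ)).support.card = 2 ^ n := by
  rw [support_map_tavenasV, card_range]

/-- A sum of `k` products of `m` `t`-sparse polynomials has at most `k t^m` monomials
(Koiran 2011 §6, the expansion bound). [cite: Koiran2011, §6 p. 317] -/
theorem card_support_sumProd_le {k m t : ℕ} (g : Fin k → Fin m → ℝ[X])
    (hg : ∀ i j, (g i j).support.card ≤ t) :
    (∑ i, ∏ j, g i j).support.card ≤ k * t ^ m := by
  calc _ ≤ ∑ i, (∏ j, g i j).support.card := card_support_sum_le _ _
    _ ≤ ∑ i, ∏ j, (g i j).support.card := sum_le_sum fun i _ => card_support_prod_le _ _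
    _ ≤ ∑ _i : Fin k, ∏ _j : Fin m, t :=
        sum_le_sum fun i _ => prod_le_prod (fun j _ => Nat.zero_le _) fun j _ => hg i j
    _ = k * t ^ m := by simp

/-- **Budget floor.** A ΣΠ-sparse expression with `k t^m < 2^n` is not `V_n`: any representation
the transfer produces must have `k · t^m ≥ 2^n`. [folklore] -/
theorem sumProd_ne_map_tavenasV_of_lt {k m t n : ℕ} (g : Fin k → Fin m → ℝ[X])
    (hg : ∀ i j, (g i j).support.card ≤ t) (hlt : k * t ^ m < 2 ^ n) :
    (∑ i, ∏ j, g i j) ≠ (tavenasV n).map (Int.castRingHom ℝ) := by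
  intro h
  have h1 := card_support_sumProd_le g hg
  rw [h, card_support_map_tavenasV] at h1
  omega

/-- **General budget lemma.** For ANY size budget `(K, M, T)` (with `T(n) ≥ 1`): if
`K(n) · T(n)^(M(n)) < 2^n` for one `n`, then `V_n` has no ΣΠ-sparse expression within the budget at
that `n`, so the transfer's conclusion with this budget is false.  (`T(n) ≥ 1` is needed: with
`T(n) = 0 < M(n)` the budget product is `0` although `m = 0`, `k = 1` represents `V_0 = 1`.) [folklore] -/
theorem realVnTransfer_conclusion_false_of_budget_lt (K M T : ℕ → ℕ)
    (h : ∃ n, 0 < T n ∧ K n * T n ^ M n < 2 ^ n) :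
    ¬ ∀ n : ℕ, ∃ (k m t : ℕ) (g : Fin k → Fin m → Polynomial ℝ),
        k ≤ K n ∧ m ≤ M n ∧ t ≤ T n ∧ (∀ i j, (g i j).support.card ≤ t) ∧
          (∑ i, ∏ j, g i j) = (tavenasV n).map (Int.castRingHom ℝ) := by
  intro hall
  obtain ⟨n, hT, hn⟩ := h
  obtain ⟨k, m, t, g, hk, hm, ht, hg, hsum⟩ := hall n
  refine sumProd_ne_map_tavenasV_of_lt g hg (lt_of_le_of_lt ?_ hn) hsum
  calc k * t ^ m ≤ K n * T n ^ m := Nat.mul_le_mul hk (Nat.pow_le_pow_left ht m)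
    _ ≤ K n * T n ^ M n := Nat.mul_le_mul_left _ (Nat.pow_le_pow_right hT hm)

/-- The arithmetic of the two refuted strengthenings: with `E = C(s+1)`, `s = ⌊√(2n+3)⌋`, both
`(n+2)^E · ((n+2)^E)^C` and `(n+2)^E · ((n+2)^C)^(C(s+1))` equal `(n+2)^((C·C + C)(s+1))`, which is
`< 2^n` for some `n = 4^j` (tree `exists_pow_sqrt_lt_two_pow`). [folklore] -/
theorem exists_budget_lt_two_pow (C : ℕ) :
    ∃ n : ℕ, (n + 2) ^ (C * (Nat.sqrt (2 * n + 3) + 1)) *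
        ((n + 2) ^ (C * (Nat.sqrt (2 * n + 3) + 1))) ^ C < 2 ^ n ∧
      (n + 2) ^ (C * (Nat.sqrt (2 * n + 3) + 1)) *
        ((n + 2) ^ C) ^ (C * (Nat.sqrt (2 * n + 3) + 1)) < 2 ^ n := by
  obtain ⟨n, hn⟩ := exists_pow_sqrt_lt_two_pow (C * C + C)
  set s : ℕ := Nat.sqrt (2 * n + 3) with hs
  have hle : (n + 2) ^ ((C * C + C) * (s + 1)) ≤ (n + 2) ^ ((C * C + C) * (s + 4)) :=
    Nat.pow_le_pow_right (by omega) (Nat.mul_le_mul_left _ (by omega))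
  refine ⟨n, ?_, ?_⟩
  · calc (n + 2) ^ (C * (s + 1)) * ((n + 2) ^ (C * (s + 1))) ^ C
        = (n + 2) ^ ((C * C + C) * (s + 1)) := by rw [← pow_mul, ← pow_add]; ring_nf
      _ < 2 ^ n := lt_of_le_of_lt hle hn
  · calc (n + 2) ^ (C * (s + 1)) * ((n + 2) ^ C) ^ (C * (s + 1))
        = (n + 2) ^ ((C * C + C) * (s + 1)) := by rw [← pow_mul, ← pow_add]; ring_nf
      _ < 2 ^ n := lt_of_le_of_lt hle hn

/-- **Where counting stops.** At the crux's OWN budget the monomial count is silent: for `C ≥ 1`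
and every `n`, `K(n) · T(n)^(M(n)) = (n+2)^(C(s+1)(1 + C(s+1))) ≥ (n+2)^((s+1)²) > (n+2)^(2n+3) ≥ 2^n`
(`s = ⌊√(2n+3)⌋`, `(s+1)² > 2n+3`).  So `m · log t = Θ(n log n)` is exactly the regime a disproof by
counting cannot reach, and the stated shape `(n+2)^(C(⌊√(2n+3)⌋+1))`, `C(⌊√(2n+3)⌋+1)` sits just
above the counting floor `k t^m ≥ 2^n`. [folklore] -/
theorem two_pow_le_stated_budget (C n : ℕ) (hC : 1 ≤ C) :
    2 ^ n ≤ (n + 2) ^ (C * (Nat.sqrt (2 * n + 3) + 1)) *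
      ((n + 2) ^ (C * (Nat.sqrt (2 * n + 3) + 1))) ^ (C * (Nat.sqrt (2 * n + 3) + 1)) := by
  set s : ℕ := Nat.sqrt (2 * n + 3) with hs
  have h1 : 2 * n + 3 < (s + 1) * (s + 1) := Nat.lt_succ_sqrt (2 * n + 3)
  have h3 : 1 * (s + 1) * (1 * (s + 1)) ≤ C * (s + 1) * (C * (s + 1)) :=
    Nat.mul_le_mul (Nat.mul_le_mul_right _ hC) (Nat.mul_le_mul_right _ hC)
  have h2 : n ≤ C * (s + 1) * (C * (s + 1)) :=
    le_trans (by omega : n ≤ 2 * n + 3) (le_trans h1.le (by simpa only [one_mul] using h3))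
  calc 2 ^ n ≤ (n + 2) ^ n := Nat.pow_le_pow_left (by omega) n
    _ ≤ (n + 2) ^ (C * (s + 1) * (C * (s + 1))) := Nat.pow_le_pow_right (by omega) h2
    _ = ((n + 2) ^ (C * (s + 1))) ^ (C * (s + 1)) := pow_mul _ _ _
    _ ≤ _ := Nat.le_mul_of_pos_left _ (by positivity)

/-! ### (c) natural strengthenings of the conclusion that are FALSE outright -/

/-- **Bounded product fan-in is impossible.** The crux's conclusion with `m ≤ C` in place of
`m ≤ C(⌊√(2n+3)⌋+1)` (everything else verbatim) is false: `k t^m ≤ (n+2)^((C²+C)(√(2n+3)+1))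
= 2^(O(√n log n)) < 2^n = #supp V_n` for large `n = 4^j`.  So the `√n` growth of the product fan-in
is load-bearing, and "RealVnTransfer with bounded fan-in" would be equivalent to the summit. [folklore] -/
theorem realVnTransfer_false_with_bounded_fanin :
    ¬ ∃ C : ℕ, ∀ n : ℕ, ∃ (k m t : ℕ) (g : Fin k → Fin m → Polynomial ℝ),
        k ≤ (n + 2) ^ (C * (Nat.sqrt (2 * n + 3) + 1)) ∧ m ≤ C ∧
        t ≤ (n + 2) ^ (C * (Nat.sqrt (2 * n + 3) + 1)) ∧ (∀ i j, (g i j).support.card ≤ t) ∧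
          (∑ i, ∏ j, g i j) = (tavenasV n).map (Int.castRingHom ℝ) := by
  rintro ⟨C, hC⟩
  refine realVnTransfer_conclusion_false_of_budget_lt
    (fun n => (n + 2) ^ (C * (Nat.sqrt (2 * n + 3) + 1))) (fun _ => C)
    (fun n => (n + 2) ^ (C * (Nat.sqrt (2 * n + 3) + 1))) ?_ hC
  obtain ⟨n, hn, -⟩ := exists_budget_lt_two_pow C
  exact ⟨n, by positivity, hn⟩

/-- **Polynomial sparsity is impossible.** The crux's conclusion with `t ≤ (n+2)^C` in place of
`t ≤ (n+2)^(C(⌊√(2n+3)⌋+1))` (everything else verbatim) is false: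
`k t^m ≤ (n+2)^(C(s+1)) · (n+2)^(C·C(s+1)) = 2^(O(√n log n)) < 2^n`.  So the inner polynomials the
transfer produces must have quasi-polynomially many monomials; only `k` may conceivably be polynomial
(`k t^m` with `t, m` at full budget is `2^(Θ(n log n))`, out of reach of counting). [folklore] -/
theorem realVnTransfer_false_with_poly_sparsity :
    ¬ ∃ C : ℕ, ∀ n : ℕ, ∃ (k m t : ℕ) (g : Fin k → Fin m → Polynomial ℝ),
        k ≤ (n + 2) ^ (C * (Nat.sqrt (2 * n + 3) + 1)) ∧ m ≤ C * (Nat.sqrt (2 * n + 3) + 1) ∧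
        t ≤ (n + 2) ^ C ∧ (∀ i j, (g i j).support.card ≤ t) ∧
          (∑ i, ∏ j, g i j) = (tavenasV n).map (Int.castRingHom ℝ) := by
  rintro ⟨C, hC⟩
  refine realVnTransfer_conclusion_false_of_budget_lt
    (fun n => (n + 2) ^ (C * (Nat.sqrt (2 * n + 3) + 1))) (fun n => C * (Nat.sqrt (2 * n + 3) + 1))
    (fun n => (n + 2) ^ C) ?_ hC
  obtain ⟨n, -, hn⟩ := exists_budget_lt_two_pow C
  exact ⟨n, by positivity, hn⟩

/-- Consequently a TRANSFER with bounded product fan-in (the crux with `m ≤ C`) already negates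
its own antecedent: it would be the statement `¬ IsPComputable (per/ℂ)` (= VH, by
`perNotPComputableComplex_iff_holds`) in disguise — a restatement of the crux in that direction is
not a repair but the summit. [folklore] -/
theorem not_isPComputable_of_transfer_bounded_fanin
    (h : IsPComputable (fun n => perPoly (Fin n) ℂ) →
      ∃ C : ℕ, ∀ n : ℕ, ∃ (k m t : ℕ) (g : Fin k → Fin m → Polynomial ℝ),
        k ≤ (n + 2) ^ (C * (Nat.sqrt (2 * n + 3) + 1)) ∧ m ≤ C ∧
        t ≤ (n + 2) ^ (C * (Nat.sqrt (2 * n + 3) + 1)) ∧ (∀ i j, (g i j).support.card ≤ t) ∧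
          (∑ i, ∏ j, g i j) = (tavenasV n).map (Int.castRingHom ℝ)) :
    ¬ IsPComputable (fun n => perPoly (Fin n) ℂ) :=
  fun hP => realVnTransfer_false_with_bounded_fanin (h hP)

/-! ### (b) corners of the stated budget -/

/-- The exponent `C = 0` fails already at `n = 1` (`k ≤ 1`, `m = 0`: the expression is the
constant `k`, while `V_1 = 1 + X`); `C` is existential, so this is a corner, not a refutation. [folklore] -/
theorem realVnTransfer_false_at_C_zero :
    ¬ ∀ n : ℕ, ∃ (k m t : ℕ) (g : Fin k → Fin m → Polynomial ℝ),
        k ≤ (n + 2) ^ (0 * (Nat.sqrt (2 * n + 3) + 1)) ∧ m ≤ 0 * (Nat.sqrt (2 * n + 3) + 1) ∧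
        t ≤ (n + 2) ^ (0 * (Nat.sqrt (2 * n + 3) + 1)) ∧ (∀ i j, (g i j).support.card ≤ t) ∧
          (∑ i, ∏ j, g i j) = (tavenasV n).map (Int.castRingHom ℝ) := by
  intro h
  obtain ⟨k, m, t, g, hk, hm, ht, hg, hsum⟩ := h 1
  simp only [zero_mul, pow_zero, nonpos_iff_eq_zero] at hk hm ht
  subst hm
  exact sumProd_ne_map_tavenasV_of_lt g hg (by rw [pow_zero, mul_one]; omega) hsum

/-- The quantifier-SWAPPED conclusion `∀ n ∃ C …` is a triviality: `V_n` is the sum of its `2^n`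
monomials (`k = 2^n ≤ (n+2)^((n+1)(s+1))`, `m = t = 1`, `C = n + 1`).  So the uniform `∃ C ∀ n` is
the entire content of the conclusion. [folklore] -/
theorem realVnTransfer_conclusion_forall_n_exists_C (n : ℕ) :
    ∃ (C k m t : ℕ) (g : Fin k → Fin m → Polynomial ℝ),
        k ≤ (n + 2) ^ (C * (Nat.sqrt (2 * n + 3) + 1)) ∧ m ≤ C * (Nat.sqrt (2 * n + 3) + 1) ∧
        t ≤ (n + 2) ^ (C * (Nat.sqrt (2 * n + 3) + 1)) ∧ (∀ i j, (g i j).support.card ≤ t) ∧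
          (∑ i, ∏ j, g i j) = (tavenasV n).map (Int.castRingHom ℝ) := by
  set s : ℕ := Nat.sqrt (2 * n + 3) with hs
  have hE : 1 ≤ (n + 1) * (s + 1) := Nat.one_le_iff_ne_zero.mpr (by positivity)
  have hpow : 1 ≤ (n + 2) ^ ((n + 1) * (s + 1)) := Nat.one_le_pow _ _ (by omega)
  refine ⟨n + 1, 2 ^ n, 1, 1, fun i _ => C ((2 : ℝ) ^ vExp n i) * X ^ (i : ℕ), ?_, hE, hpow, ?_, ?_⟩
  · calc 2 ^ n ≤ (n + 2) ^ n := Nat.pow_le_pow_left (by omega) n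
      _ ≤ (n + 2) ^ ((n + 1) * (s + 1)) := Nat.pow_le_pow_right (by omega) (by nlinarith)
  · intro i j
    exact card_support_C_mul_X_pow_le_one
  · rw [map_tavenasV]
    simp only [Finset.prod_const, Finset.card_univ, Fintype.card_fin, pow_one]
    exact Fin.sum_univ_eq_sum_range (fun i => C ((2 : ℝ) ^ vExp n i) * X ^ i) (2 ^ n)

/-! ### (a) the antecedent is load-bearing (unless the route's target is false) -/

/-- With the antecedent `IsPComputable (per/ℂ)` dropped, the crux's conclusion (verbatim) is refuted
by the route's own target `VnSparseHard`: any proof of the crux must use the antecedent, or else the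
route is dead. [folklore] -/
theorem realVnTransfer_conclusion_false_of_vnSparseHard (hV : VnSparseHard) :
    ¬ ∃ C : ℕ, ∀ n : ℕ, ∃ (k m t : ℕ) (g : Fin k → Fin m → Polynomial ℝ),
        k ≤ (n + 2) ^ (C * (Nat.sqrt (2 * n + 3) + 1)) ∧ m ≤ C * (Nat.sqrt (2 * n + 3) + 1) ∧
        t ≤ (n + 2) ^ (C * (Nat.sqrt (2 * n + 3) + 1)) ∧ (∀ i j, (g i j).support.card ≤ t) ∧
          (∑ i, ∏ j, g i j) = (tavenasV n).map (Int.castRingHom ℝ) := by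
  rintro ⟨C, hC⟩
  obtain ⟨n, -, hn⟩ := hV C 0
  obtain ⟨k, m, t, g, hk, hm, ht, hg, hsum⟩ := hC n
  exact hn k m t g hk hm ht hg hsum

/-- **Irrefutability by design.** A refutation of the crux would PROVE its antecedent, i.e.
p-computability of the permanent over `ℂ` (`VP_ℂ = VNP_ℂ` for this family, by
`perNotPComputableComplex_iff_holds`): no counterexample search is meaningful. [folklore] -/
theorem isPComputable_of_not_realVnTransfer (h : ¬ RealVnTransfer) :
    IsPComputable (fun n => perPoly (Fin n) ℂ) := by
  by_contra hP
  exact h fun hP' => absurd hP' hP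

end Summit.ValiantsHypothesis.ValiantsHypothesis.Theorems.RealVnTransfer.Negative
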